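import Literature.Probability.LatticeModels.LatticeHarnackConformal
import HarnessLib

/-!
# Harnack's inequality and the gradient estimate in conformal coordinates for functions that are
# lattice-harmonic only away from the boundary (LSW 2004, Lemma 5.2, local form)

Topic `Literature/Probability/LatticeModels`; companion of `LatticeHarnackConformal.lean`, whose
`harnack_conformal` / `lipschitz_conformal` (G. F. Lawler, O. Schramm, W. Werner, *Conformal
invariance of planar loop-erased random walks and uniform spanning trees*, Ann. Probab. 32 (2004),
Lemma 5.2, cases `k = 0, 1`) assume the function `h ≥ 0` lattice-harmonic at EVERY site of the
domain `F(𝔻)`. In the proof of Prop. 2.2 of the same paper (§5.2) the lemma is applied to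
`h = H(·,u)/H(0,u) = G(·,q)/G(0,q)`, which is harmonic at every site EXCEPT the site `q` next to
the boundary vertex of the dart `u` (in the tree's rendering with functions on `ℤ²` vanishing off
`V(D)`, the pole of the Green function). The printed proof of Lemma 5.2 only ever uses harmonicity
on boxes of size comparable to, and well inside, the distance to the boundary ("a sequence
`0 = v₀, v₁, …, v_ℓ = v` in `V_D` with `|v_j - v_{j-1}| ≤ dist(v_j, ∂D)/10`"), so it proves the
following LOCAL form, which is what this file records, with the same constants:

* `harnack_conformal_local`, `lipschitz_conformal_local` — as `harnack_conformal`,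
  `lipschitz_conformal`, but with the hypothesis "`h` is lattice-harmonic at every site `x` whose
  mesh point has the disc `B(x, 64) ⊆ F(𝔻)`" (any margin below `ρ₀(1-r)²/128 - 97` would do;
  `64` covers the pole of `G(·, q)`, which is within distance `1` of the complement).

The proofs are those of `LatticeHarnackConformal.lean` verbatim, except for the one line where
the harmonicity hypothesis is invoked: the boxes of the Harnack chain (radius `48k`,
`k = ⌊ρ₀(1-r)²/4096⌋`, about points `w_j` with `B(w_j, ρ₀(1-r)²/32) ⊆ F(𝔻)`) and of the gradient
estimate keep a margin `≥ ρ₀(1-r)²/128 ≥ 78 > 64` from the complement. Everything is proved; no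
named fact.

## References

* G. F. Lawler, O. Schramm, W. Werner, Ann. Probab. 32 (2004), Lemma 5.2 and its proof
  (arXiv p. 27); §5.2 (application to `h = H(·,u)/H(0,u)`). [LawlerSchrammWerner2004]
-/

noncomputable section

namespace Literature.Probability.LatticeModels

open Set Metric Literature.Analysis.Complex

/-! ### Harnack's inequality in conformal coordinates, local form -/

/-- **Harnack's inequality in conformal coordinates, for functions harmonic away from the
boundary** (Lawler–Schramm–Werner 2004, Lemma 5.2, case `k = 0`, both directions). Let `F` be
holomorphic and injective on `𝔻` with `B(F 0, ρ₀) ⊆ F(𝔻)` and an omitted value `b ∉ F(𝔻)` with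
`‖b - F 0‖ ≤ 2ρ₀`; let `h ≥ 0` on `ℤ²` be lattice harmonic on a set `U` containing every site `x`
with `B(x, 64) ⊆ F(𝔻)`; let `r < 1` with `ρ₀ (1-r)² ≥ 10⁴` and `N ≥ 11000/(1-r)⁵`. Then for every
`|ζ| ≤ r`, writing `v`, `v₀` for the sites nearest to `F ζ`, `F 0`: `(c_*/2)^N h(v₀) ≤ h(v)` and
`(c_*/2)^N h(v) ≤ h(v₀)`. [cite: LawlerSchrammWerner2004, Lemma 5.2] -/
theorem harnack_conformal_local {F : ℂ → ℂ} (hF : DifferentiableOn ℂ F (ball 0 1))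
    (hinj : InjOn F (ball 0 1)) {ρ₀ : ℝ} (hρ₀ : 0 < ρ₀) (hsub : ball (F 0) ρ₀ ⊆ F '' ball 0 1)
    {b : ℂ} (hb : b ∉ F '' ball 0 1) (hbρ : ‖b - F 0‖ ≤ 2 * ρ₀)
    {h : Site 2 → ℝ} (hpos : ∀ w, 0 ≤ h w) {U : Set (Site 2)} (hh : IsLatticeHarmonicOn h U)
    (hU : ∀ x : Site 2, ball (meshPoint 1 x) 64 ⊆ F '' ball 0 1 → x ∈ U)
    {r : ℝ} (hr : r < 1) (hbig : 10000 ≤ ρ₀ * (1 - r) ^ 2)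
    {N : ℕ} (hN : 11000 / (1 - r) ^ 5 ≤ N) {ζ : ℂ} (hζ : ‖ζ‖ ≤ r) :
    (maneuverConst / 2) ^ N * h (nearestSite 1 (F 0)) ≤ h (nearestSite 1 (F ζ)) ∧
      (maneuverConst / 2) ^ N * h (nearestSite 1 (F ζ)) ≤ h (nearestSite 1 (F 0)) := by
  have hr0 : 0 ≤ r := (norm_nonneg _).trans hζ
  have h1r : 0 < 1 - r := by linarith
  have h1r1 : 1 - r ≤ 1 := by linarith
  set A : ℝ := ρ₀ * (1 - r) ^ 2 with hA
  have hA0 : 0 ≤ A := by positivity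
  -- `(1 - r)^5 ≤ 1`, so `N ≥ 11000 ≥ 1`
  have hpow5 : (1 - r) ^ 5 ≤ 1 := pow_le_one₀ h1r.le h1r1
  have hpow5' : 0 < (1 - r) ^ 5 := pow_pos h1r 5
  have hNr : (11000 : ℝ) ≤ N := by
    have : (11000 : ℝ) ≤ 11000 / (1 - r) ^ 5 := by
      rw [le_div_iff₀ hpow5']; nlinarith
    exact this.trans hN
  have hN0 : 0 < N := by exact_mod_cast (show (0 : ℝ) < N by linarith)
  have hNpos : (0 : ℝ) < N := by exact_mod_cast hN0
  -- the box scale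
  set k : ℕ := ⌊A / 4096⌋₊ with hk
  have hkle : (k : ℝ) ≤ A / 4096 := Nat.floor_le (by positivity)
  have hklt : A / 4096 < k + 1 := Nat.lt_floor_add_one _
  have hkpos : 0 < k := by
    have : (1 : ℝ) < k := by
      have : (10000 : ℝ) / 4096 ≤ A / 4096 := by gcongr
      linarith
    exact_mod_cast (show (0 : ℝ) < k by linarith)
  -- the Koebe chain
  obtain ⟨hw0, hwN, hball, hstep⟩ :=
    KoebeInterior.chain hF hinj hρ₀ hsub hb hbρ hζ hr hN0
  set w : ℕ → ℂ := fun j ↦ F ((j / N : ℝ) * ζ) with hw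
  set c : ℕ → Site 2 := fun j ↦ nearestSite 1 (w j) with hc
  have hc0 : c 0 = nearestSite 1 (F 0) := by
    show nearestSite 1 (F (((0 : ℕ) / N : ℝ) * ζ)) = _
    simp
  have hcN : c N = nearestSite 1 (F ζ) := by
    show nearestSite 1 (F (((N : ℕ) / N : ℝ) * ζ)) = _
    rw [div_self hNpos.ne']; simp
  -- (1) the big boxes, together with a margin `64`, lie in `F(𝔻)`, hence in `U`
  have hbox : ∀ j ≤ N, IsLatticeHarmonicOn h (mW (c j) k) := by
    intro j hj x hx
    refine hh x (hU x fun y hy => hball j hj ?_)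
    rw [mem_ball, dist_eq_norm] at hy ⊢
    have h1 := norm_sub_le_of_mem_mW hx
    have h2 := norm_meshPoint_nearestSite_sub_le (w j)
    calc ‖y - F ((j / N : ℝ) * ζ)‖
        = ‖(y - meshPoint 1 x) + ((meshPoint 1 x - meshPoint 1 (c j)) + (meshPoint 1 (c j) - w j))‖ := by
          simp only [hc, hw, sub_add_sub_cancel]
      _ ≤ ‖y - meshPoint 1 x‖ + (‖meshPoint 1 x - meshPoint 1 (c j)‖ + ‖meshPoint 1 (c j) - w j‖) :=
          (norm_add_le _ _).trans (add_le_add le_rfl (norm_add_le _ _))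
      _ ≤ 64 + (96 * k + 1) := add_le_add hy.le (add_le_add h1 h2)
      _ ≤ 64 + (96 * (A / 4096) + 1) := by gcongr
      _ < ρ₀ * (1 - r) ^ 2 / 32 := by rw [← hA]; nlinarith
  -- (2) consecutive centres are within `12k`
  have hsteps : ∀ j < N, c (j + 1) ∈ mB (c j) k := by
    intro j hj
    refine mem_mB_of_norm_le ?_
    have h1 := norm_meshPoint_nearestSite_sub_le (w (j + 1))
    have h2 := norm_meshPoint_nearestSite_sub_le (w j)
    have h3 := hstep j hj
    have hρ16 : 8 * (2 * ρ₀) / (1 - r) ^ 3 * (r / N) ≤ 16 * A / 11000 := by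
      -- `r ≤ 1`, `1/N ≤ (1-r)^5/11000`
      have hN' : (1 : ℝ) / N ≤ (1 - r) ^ 5 / 11000 := by
        rw [div_le_div_iff₀ hNpos (by norm_num)]
        have := (div_le_iff₀ hpow5').1 hN
        linarith
      have hp3 : 0 < (1 - r) ^ 3 := pow_pos h1r 3
      calc 8 * (2 * ρ₀) / (1 - r) ^ 3 * (r / N) ≤ 8 * (2 * ρ₀) / (1 - r) ^ 3 * (1 / N) := by
            gcongr
        _ ≤ 8 * (2 * ρ₀) / (1 - r) ^ 3 * ((1 - r) ^ 5 / 11000) := by gcongr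
        _ = 16 * A / 11000 := by
            rw [hA]; field_simp; ring
    calc ‖meshPoint 1 (c (j + 1)) - meshPoint 1 (c j)‖
        = ‖(meshPoint 1 (c (j + 1)) - w (j + 1)) + (w (j + 1) - w j) - (meshPoint 1 (c j) - w j)‖ := by
          ring_nf
      _ ≤ ‖meshPoint 1 (c (j + 1)) - w (j + 1)‖ + ‖w (j + 1) - w j‖ + ‖meshPoint 1 (c j) - w j‖ := by
          refine (norm_sub_le _ _).trans ?_
          gcongr
          exact norm_add_le _ _
      _ ≤ 1 + 8 * (2 * ρ₀) / (1 - r) ^ 3 * (r / N) + 1 := by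
          gcongr
      _ ≤ 2 + 16 * A / 11000 := by linarith
      _ ≤ 12 * (A / 4096 - 1) := by nlinarith
      _ ≤ 12 * k := by linarith
  -- forward chain
  have hfwd := harnack_chain hpos hkpos c N hbox hsteps
  rw [hc0, hcN] at hfwd
  -- backward chain
  set c' : ℕ → Site 2 := fun j ↦ c (N - j) with hc'
  have hbox' : ∀ j ≤ N, IsLatticeHarmonicOn h (mW (c' j) k) := fun j _ ↦ hbox (N - j) (Nat.sub_le N j)
  have hsteps' : ∀ j < N, c' (j + 1) ∈ mB (c' j) k := by
    intro j hj
    have hidx : N - j = (N - (j + 1)) + 1 := by omega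
    have hm := hsteps (N - (j + 1)) (by omega)
    rw [← hidx] at hm
    -- symmetry of the box relation
    obtain ⟨hm0, hm1⟩ := hm
    refine ⟨?_, ?_⟩
    · simpa only [hc', abs_sub_comm] using hm0
    · simpa only [hc', abs_sub_comm] using hm1
  have hbwd := harnack_chain hpos hkpos c' N hbox' hsteps'
  have hc'0 : c' 0 = nearestSite 1 (F ζ) := by simp only [hc', Nat.sub_zero]; exact hcN
  have hc'N : c' N = nearestSite 1 (F 0) := by simp only [hc', Nat.sub_self]; exact hc0
  rw [hc'0, hc'N] at hbwd
  exact ⟨hfwd, hbwd⟩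

/-! ### The Lipschitz bound in conformal coordinates, local form -/

/-- **Discrete derivative estimate in conformal coordinates, for functions harmonic away from the
boundary** (Lawler–Schramm–Werner 2004, Lemma 5.2, case `k = 1`). In the setting of
`harnack_conformal_local`, with `ρ₀ (1-r)² ≥ 4·10⁴` and `N ≥ 352000/(1-r)⁵`: for every site `x`
whose mesh point is within `1` of a point `F ζ`, `|ζ| ≤ r`, and every lattice direction `e_k`,
`|h(x + e_k) - h(x)| ≤ 1024 C_top (2/c_*)^N h(v₀) / (ρ₀ (1-r)²)`, `v₀` the site nearest to `F 0`.
[cite: LawlerSchrammWerner2004, Lemma 5.2] -/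
theorem lipschitz_conformal_local {F : ℂ → ℂ} (hF : DifferentiableOn ℂ F (ball 0 1))
    (hinj : InjOn F (ball 0 1)) {ρ₀ : ℝ} (hρ₀ : 0 < ρ₀) (hsub : ball (F 0) ρ₀ ⊆ F '' ball 0 1)
    {b : ℂ} (hb : b ∉ F '' ball 0 1) (hbρ : ‖b - F 0‖ ≤ 2 * ρ₀)
    {h : Site 2 → ℝ} (hpos : ∀ w, 0 ≤ h w) {U : Set (Site 2)} (hh : IsLatticeHarmonicOn h U)
    (hU : ∀ x : Site 2, ball (meshPoint 1 x) 64 ⊆ F '' ball 0 1 → x ∈ U)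
    {r : ℝ} (hr : r < 1) (hbig : 40000 ≤ ρ₀ * (1 - r) ^ 2)
    {N : ℕ} (hN : 352000 / (1 - r) ^ 5 ≤ N) {ζ : ℂ} (hζ : ‖ζ‖ ≤ r)
    {x : Site 2} (hx : ‖meshPoint 1 x - F ζ‖ ≤ 1) (k : Fin 4) :
    |h (x + cornerUnit k) - h x| ≤
      1024 * topGradConst * (2 / maneuverConst) ^ N * h (nearestSite 1 (F 0)) / (ρ₀ * (1 - r) ^ 2) := by
  have hr0 : 0 ≤ r := (norm_nonneg _).trans hζ
  have h1r : 0 < 1 - r := by linarith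
  set A : ℝ := ρ₀ * (1 - r) ^ 2 with hA
  have hA0 : 0 < A := by positivity
  have hc := maneuverConst_pos
  have hK := topGradConst_pos
  set v₀ : Site 2 := nearestSite 1 (F 0) with hv₀
  set M : ℝ := (2 / maneuverConst) ^ N * h v₀ with hM
  have hM0 : 0 ≤ M := mul_nonneg (by positivity) (hpos v₀)
  -- the box radius
  set q : ℕ := ⌊A / 256⌋₊ with hq
  have hqle : (q : ℝ) ≤ A / 256 := Nat.floor_le (by positivity)
  have hqlt : A / 256 < q + 1 := Nat.lt_floor_add_one _
  have hq8 : 8 ≤ q := by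
    have : (8 : ℝ) ≤ q := by
      have : (40000 : ℝ) / 256 ≤ A / 256 := by gcongr
      linarith
    exact_mod_cast this
  have hN16 : 16 ≤ 2 * q := by omega
  have h2q : A / 256 ≤ (2 * q : ℕ) := by push_cast; linarith
  -- sites within `ℓ^∞`-distance `q` of `x` are conformal-interior points at radius `(1+r)/2`
  set r' : ℝ := (1 + r) / 2 with hr'
  have hr'1 : r' < 1 := by rw [hr']; linarith
  have h1r' : 1 - r' = (1 - r) / 2 := by rw [hr']; ring
  have hbig' : 10000 ≤ ρ₀ * (1 - r') ^ 2 := by rw [h1r']; nlinarith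
  have hN' : 11000 / (1 - r') ^ 5 ≤ N := by
    rw [h1r', div_pow]
    have : (11000 : ℝ) / ((1 - r) ^ 5 / 2 ^ 5) = 352000 / (1 - r) ^ 5 := by
      field_simp; norm_num
    rw [this]; exact hN
  have hnear : ∀ y : Site 2, |y 0 - x 0| ≤ q → |y 1 - x 1| ≤ q → h y ≤ M ∧ y ∈ U := by
    intro y hy0 hy1
    have hdist : ‖meshPoint 1 y - F ζ‖ < (1 - r) / 2 * ρ₀ * (1 - r) / 32 := by
      have h1 : ‖meshPoint 1 y - meshPoint 1 x‖ ≤ 2 * q := by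
        have := norm_meshPoint_sub_le y x
        have h2 : ((|y 0 - x 0| + |y 1 - x 1| : ℤ) : ℝ) ≤ ((q + q : ℤ) : ℝ) := by
          exact_mod_cast add_le_add hy0 hy1
        push_cast at this h2 ⊢
        linarith
      calc ‖meshPoint 1 y - F ζ‖ = ‖(meshPoint 1 y - meshPoint 1 x) + (meshPoint 1 x - F ζ)‖ := by
            rw [sub_add_sub_cancel]
        _ ≤ ‖meshPoint 1 y - meshPoint 1 x‖ + ‖meshPoint 1 x - F ζ‖ := norm_add_le _ _
        _ ≤ 2 * q + 1 := add_le_add h1 hx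
        _ ≤ 2 * (A / 256) + 1 := by gcongr
        _ < (1 - r) / 2 * ρ₀ * (1 - r) / 32 := by rw [hA] at *; nlinarith
    obtain ⟨ζ', hζ'ζ, -, hFζ'⟩ := KoebeInterior.exists_apply_eq_of_norm_sub_lt hF hinj hρ₀ hsub hζ hr
      (by linarith : 0 < (1 - r) / 2) (by linarith) hdist
    have hζ' : ‖ζ'‖ ≤ r' := by
      have : ‖ζ'‖ ≤ ‖ζ' - ζ‖ + ‖ζ‖ := by
        calc ‖ζ'‖ = ‖(ζ' - ζ) + ζ‖ := by rw [sub_add_cancel]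
          _ ≤ ‖ζ' - ζ‖ + ‖ζ‖ := norm_add_le _ _
      rw [hr']; linarith
    -- the margin: `B(F ζ', ρ₀(1-r')²/32) ⊆ F(𝔻)` and `ρ₀(1-r')²/32 = A/128 ≥ 64`
    have hyF : ball (meshPoint 1 y) 64 ⊆ F '' ball 0 1 := by
      rw [← hFζ']
      refine (ball_subset_ball ?_).trans (KoebeInterior.ball_subset_image_of_norm_le hF hinj hρ₀ hsub hζ' hr'1)
      rw [h1r']
      rw [hA] at hqle hqlt h2q
      nlinarith
    refine ⟨?_, hU y hyF⟩
    have hH := (harnack_conformal_local hF hinj hρ₀ hsub hb hbρ hpos hh hU hr'1 hbig' hN' hζ').2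
    rw [hFζ', nearestSite_meshPoint one_ne_zero] at hH
    -- `(c_*/2)^N h y ≤ h v₀`
    have hcN : 0 < (maneuverConst / 2) ^ N := by positivity
    rw [hM, div_pow, show (2 : ℝ) ^ N / maneuverConst ^ N = ((maneuverConst / 2) ^ N)⁻¹ by
      rw [div_pow, inv_div]]
    rw [← div_eq_inv_mul, le_div_iff₀ hcN, mul_comm]
    exact hH
  -- harmonicity on the box interior and the bound on the sides
  have hharm : IsLatticeHarmonicOn h (boxInterior (cornerOf x q) (2 * q)) := by
    intro y hy
    obtain ⟨k0, k0', k1, k1'⟩ := hy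
    simp only [cornerOf, Matrix.cons_val_zero, Matrix.cons_val_one] at k0 k0' k1 k1'
    push_cast at k0' k1'
    refine hh y (hnear y ?_ ?_).2 <;> rw [abs_le] <;> constructor <;> omega
  have hsides : ∀ i : ℕ, 0 < i → i < 2 * q →
      |h ![cornerOf x q 0 + i, cornerOf x q 1 + (2 * q : ℕ)]| ≤ M ∧
      |h ![cornerOf x q 0 + i, cornerOf x q 1]| ≤ M ∧
      |h ![cornerOf x q 0, cornerOf x q 1 + i]| ≤ M ∧
      |h ![cornerOf x q 0 + (2 * q : ℕ), cornerOf x q 1 + i]| ≤ M := by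
    intro i hi hiq
    have habs : ∀ y : Site 2, |y 0 - x 0| ≤ q → |y 1 - x 1| ≤ q → |h y| ≤ M := fun y hy0 hy1 ↦ by
      rw [abs_of_nonneg (hpos y)]; exact (hnear y hy0 hy1).1
    refine ⟨habs _ ?_ ?_, habs _ ?_ ?_, habs _ ?_ ?_, habs _ ?_ ?_⟩
    all_goals
      simp only [cornerOf, Matrix.cons_val_zero, Matrix.cons_val_one]
      push_cast
      rw [abs_le]; constructor <;> omega
  have hgrad := harmonic_box_gradient_le (cornerOf x q) (2 * q) hN16 hharm hM0 hsides
    (mem_boxMiddle_cornerOf x q) k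
  refine hgrad.trans ?_
  -- `4 K M / (2q) ≤ 1024 K M / A`
  have h2q0 : (0 : ℝ) < (2 * q : ℕ) := by positivity
  rw [div_le_div_iff₀ h2q0 hA0, hM]
  have hKM : 0 ≤ topGradConst * ((2 / maneuverConst) ^ N * h v₀) := mul_nonneg hK.le hM0
  nlinarith [mul_le_mul_of_nonneg_left h2q hKM]

end Literature.Probability.LatticeModels

end
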